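import Literature.Probability.Percolation.MarkedLoopRotation
import Literature.Probability.Percolation.MarkedLoopTripodCuts
import HarnessLib

/-!
# The rotated fan weights are linearly independent at every odd number of marks («FAN-RANK-ALL»)

For `k = 2l+1 ≥ 5` the `k` rotated copies `rotW (rot k ^ s) (fanWt l)` (`s < k`) of the tree's FAN WEIGHT (`MarkedLoopHolomorphy.fanWt`:
`−(−τ²)^m` on the fan pattern with apex `m ≤ l`) are LINEARLY INDEPENDENT in the space `Fin k → Finset (Fin k × Fin k) → ℂ` of all
class/relation weights. Read them at the rotated copies `(rot^t 1; rot^t (fanRel l 1))` of the apex-`1` fan pattern: the rotated fan `s`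
is non-zero there iff `k ∣ s + t` (★ `rotW_fanWt_apply_rot`), because (★ `dvd_of_relMap_fanRel_one`, SEPARATION) a rotation carrying the
apex-`1` fan relation onto an apex-`m` fan relation with `m ≤ l` must be trivial — the image `(m−1, m−2)` of the chord `{0, 2l}` is a chord of
`fanRel l m` only if `m = 1` (parity of `2m − 3` vs `2l`, `2l+1`). Hence ★★ `linearIndependent_rotW_fanWt (hl : 2 ≤ l)` (in the function
space). § OnPatterns: `mem_fanRel_one`, ★ `isPattern_fanRel_one` (the apex-`1` fan is a pattern), `fanPat₁` (its rotated copies, by the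
tree's `IsPattern.map`), `fanSol l s : solW k` (the rotated fans as solutions, `tripodLaw_rotW_fanWt`), ★★ `linearIndependent_fanSol` —
THE `k` ROTATED FANS ARE INDEPENDENT SOLUTIONS OF THE TRIPOD LAW, ★★ `le_finrank_solW : k ≤ dim solW k` and `le_card_ncMatching :
k ≤ #NCMatching (k+1)` for every odd `k ≥ 5`.

Context (the lane's, Khristoforov–Smirnov treat three disorders): `dim solW k = #NCMatching (k+1)` (`MarkedLoopTripodBasis`); at `k = 5`
the five rotated fans are a basis (`MarkedLoopTripodBasisFive.fanBasis`), at `k = 7` they span `7` of `14` dimensions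
(`MarkedLoopTripodBasisSeven`, when in the tree); `k = 3` is genuinely excluded (three fans in a 2-dimensional space). No percolation statement.

References: [KhS21] M. Khristoforov, S. Smirnov, *Percolation and O(1) loop model*, arXiv:2111.15612v1 (2021), §1.2 (p. 2: cyclic
indexing, link patterns), §2 Definition 3 and Lemma 4 (p. 4), Remark 6 (p. 5); [BR06] B. Bollobás, O. Riordan, *Percolation*, CUP 2006,
Ch. 7 (context only). Tree: `MarkedLoopRotation.lean` (`rot`, `val_rot_pow`, `relMap`, `mem_relMap_apply`, `relMap_trans`, `relMap_refl`,
`rotW`, `isCyc_rot_pow`, `tripodLaw_rotW_fanWt`), `MarkedLoopHolomorphy.lean` (`fanRel`, `mem_fanRel`, `fanWt`), `MarkedLoopTripodCuts.lean`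
(`IsPattern.map`), `MarkedLoopTripodBasis.lean` (`IsPattern`, `Pat`, `solW`, `restrictW`, `tripodLaw_iff_restrict_mem_solW`,
`finrank_solW_eq_card_ncMatching`). Tactics: residue arithmetic by `omega` after `Nat.add_mod`,
`interval_cases`, `Fintype.linearIndependent_iff` + `Finset.sum_eq_single`.
-/

namespace Literature.Probability.Percolation.MarkedLoops

open Literature.Probability.Percolation.FivePoint (tau)

variable {l : ℕ}

/-- `τ ≠ 0`. [folklore] -/
private theorem tau_ne_zero_fr : tau ≠ 0 := by
  unfold tau; exact Complex.exp_ne_zero _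

/-- the value of `rot^u` on a corner, as a residue. [cite: KhristoforovSmirnov2021, §1.2 (arXiv v1 p. 2: cyclic indexing)] -/
theorem val_rot_pow_mk (u i : ℕ) (h : i < 2 * l + 1) :
    ((rot (2 * l + 1) ^ u) ⟨i, h⟩).val = (i + u) % (2 * l + 1) := by
  rw [val_rot_pow]

/-- ★ **SEPARATION**: if `rot^u` moves the apex `1` to an apex `m ≤ l` and carries the apex-`1` fan relation onto the apex-`m` fan relation,
then `k ∣ u` (`k = 2l+1 ≥ 5`): the image `(rot^u 0, rot^u (2l)) = (m−1, m−2)` of the chord `{0, 2l}` is not a chord of `fanRel l m`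
unless `m = 1`.
[cite: KhristoforovSmirnov2021, §1.2 (arXiv v1 p. 2); §2 Definition 3 (p. 4)] -/
theorem dvd_of_relMap_fanRel_one (hl : 2 ≤ l) {u : ℕ}
    (hm : ((rot (2 * l + 1) ^ u) ⟨1, by omega⟩).val ≤ l)
    (hrel : relMap (rot (2 * l + 1) ^ u) (fanRel l 1) = fanRel l ((rot (2 * l + 1) ^ u) ⟨1, by omega⟩).val) :
    (2 * l + 1) ∣ u := by
  set m := ((rot (2 * l + 1) ^ u) ⟨1, by omega⟩).val with hmdef
  have hmval : m = (1 + u) % (2 * l + 1) := by rw [hmdef, val_rot_pow]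
  -- the chord {0, 2l} of the apex-1 fan and its image
  have h0 : ((⟨0, by omega⟩ : Fin (2 * l + 1)), (⟨2 * l, by omega⟩ : Fin (2 * l + 1))) ∈ fanRel l 1 := by
    rw [mem_fanRel]; left; simp
  have himg : ((rot (2 * l + 1) ^ u) ⟨0, by omega⟩, (rot (2 * l + 1) ^ u) ⟨2 * l, by omega⟩) ∈ fanRel l m := by
    rw [← hrel]; exact mem_relMap_apply.2 h0
  rw [mem_fanRel] at himg
  have ha : ((rot (2 * l + 1) ^ u) (⟨0, by omega⟩ : Fin (2 * l + 1))).val = (0 + u) % (2 * l + 1) := val_rot_pow _ _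
  have hb : ((rot (2 * l + 1) ^ u) (⟨2 * l, by omega⟩ : Fin (2 * l + 1))).val = (2 * l + u) % (2 * l + 1) := val_rot_pow _ _
  rw [ha, hb] at himg
  rw [hmval] at hm himg
  -- residue arithmetic: write u = q k + r
  rw [Nat.dvd_iff_mod_eq_zero]
  have hk : 0 < 2 * l + 1 := by omega
  have hr := Nat.mod_lt u hk
  have e1 : (1 + u) % (2 * l + 1) = (1 + u % (2 * l + 1)) % (2 * l + 1) := by rw [Nat.add_mod, Nat.one_mod_eq_one.mpr (by omega)]
  have e0 : (0 + u) % (2 * l + 1) = u % (2 * l + 1) := by rw [Nat.zero_add]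
  have e2 : (2 * l + u) % (2 * l + 1) = (2 * l + u % (2 * l + 1)) % (2 * l + 1) := by
    rw [Nat.add_mod, Nat.mod_eq_of_lt (by omega : 2 * l < 2 * l + 1)]
  rw [e1] at hm himg; rw [e0, e2] at himg
  set r := u % (2 * l + 1) with hrdef
  -- case analysis on r: r = 0 fine; otherwise derive a contradiction from himg
  by_contra hne
  have hr1 : 1 ≤ r := Nat.one_le_iff_ne_zero.2 hne
  by_cases hr2 : r = 2 * l
  · -- then m = 0: the image pair has values (2l, 2l-1)
    rw [hr2] at himg hm
    have q1 : (1 + 2 * l) % (2 * l + 1) = 0 := by rw [show 1 + 2 * l = 2 * l + 1 by ring, Nat.mod_self]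
    have q2 : (2 * l + 2 * l) % (2 * l + 1) = 2 * l - 1 := by
      rw [show 2 * l + 2 * l = (2 * l + 1) + (2 * l - 1) by omega, Nat.add_mod_left, Nat.mod_eq_of_lt (by omega)]
    rw [q1] at hm himg; rw [q2] at himg
    omega
  · -- 1 ≤ r ≤ 2l-1: m = r + 1 ≥ 2 and the image pair has values (r, r-1)
    have q1 : (1 + r) % (2 * l + 1) = r + 1 := by rw [Nat.mod_eq_of_lt (by omega)]; ring
    have q2 : (2 * l + r) % (2 * l + 1) = r - 1 := by
      rw [show 2 * l + r = (2 * l + 1) + (r - 1) by omega, Nat.add_mod_left, Nat.mod_eq_of_lt (by omega)]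
    rw [q1] at hm himg; rw [q2] at himg
    omega

/-- ★ the rotated fan `s` evaluated at the `t`-th rotated copy of the apex-`1` fan pattern: `τ²` if `k ∣ s + t`, else `0`.
[cite: KhristoforovSmirnov2021, §2 Definition 3 (arXiv v1 p. 4); Remark 6 (p. 5)] -/
theorem rotW_fanWt_apply_rot (hl : 2 ≤ l) (s t : ℕ) :
    rotW (rot (2 * l + 1) ^ s) (fanWt l) ((rot (2 * l + 1) ^ t) ⟨1, by omega⟩) (relMap (rot (2 * l + 1) ^ t) (fanRel l 1)) =
      if (2 * l + 1) ∣ s + t then tau ^ 2 else 0 := by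
  unfold rotW
  rw [← Equiv.Perm.mul_apply, ← pow_add, ← relMap_trans, ← Equiv.Perm.mul_def, ← pow_add]
  -- `rot^u` is the identity iff `k ∣ u`
  have hid : ∀ u : ℕ, (2 * l + 1) ∣ u → rot (2 * l + 1) ^ u = 1 := by
    intro u hu
    ext x
    rw [val_rot_pow, Equiv.Perm.coe_one, id_eq]
    obtain ⟨q, hq⟩ := hu
    rw [hq, Nat.add_mul_mod_self_left, Nat.mod_eq_of_lt x.isLt]
  unfold fanWt
  by_cases hdvd : (2 * l + 1) ∣ s + t
  · have hrefl : relMap (1 : Equiv.Perm (Fin (2 * l + 1))) (fanRel l 1) = fanRel l 1 := relMap_refl _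
    rw [if_pos hdvd, hid _ hdvd, Equiv.Perm.one_apply, hrefl, if_pos ⟨by show 1 ≤ l; omega, rfl⟩]
    show -((-tau ^ 2) ^ 1) = tau ^ 2
    ring
  · rw [if_neg hdvd, if_neg]
    rintro ⟨hm, hrel⟩
    exact hdvd (dvd_of_relMap_fanRel_one hl hm hrel)

/-- ★★ **THE `k` ROTATED FAN WEIGHTS ARE LINEARLY INDEPENDENT** for every `k = 2l+1 ≥ 5` (in the space of all class/relation weights).
[cite: KhristoforovSmirnov2021, §2 Definition 3 and Lemma 4 (arXiv v1 p. 4); Remark 6 (p. 5)] -/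
theorem linearIndependent_rotW_fanWt (hl : 2 ≤ l) :
    LinearIndependent ℂ (fun s : Fin (2 * l + 1) => rotW (rot (2 * l + 1) ^ s.val) (fanWt l)) := by
  rw [Fintype.linearIndependent_iff]
  intro g hg s₀
  -- evaluate at the `t`-th rotated apex-1 fan pattern with `k ∣ s₀ + t`
  set t : ℕ := 2 * l + 1 - s₀.val with ht
  have h := congrFun (congrFun hg ((rot (2 * l + 1) ^ t) ⟨1, by omega⟩)) (relMap (rot (2 * l + 1) ^ t) (fanRel l 1))
  simp only [Finset.sum_apply, Pi.smul_apply, smul_eq_mul, Pi.zero_apply] at h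
  have hs₀ := s₀.isLt
  rw [Finset.sum_eq_single s₀] at h
  · rw [rotW_fanWt_apply_rot hl, if_pos ⟨1, by omega⟩] at h
    exact (mul_eq_zero.1 h).resolve_right (pow_ne_zero _ tau_ne_zero_fr)
  · intro s _ hs
    rw [rotW_fanWt_apply_rot hl, if_neg, mul_zero]
    intro hdvd
    apply hs
    apply Fin.ext
    have hs' := s.isLt
    obtain ⟨q, hq⟩ := hdvd
    -- `s + t = q·k` with `0 < s + t < 2k` forces `q = 1` and `s = s₀`
    rcases Nat.lt_or_ge q 2 with hq2 | hq2
    · interval_cases q <;> omega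
    · have := Nat.mul_le_mul_left (2 * l + 1) hq2; omega
  · intro h0; exact absurd (Finset.mem_univ _) h0

/-! ### On the patterns: the fans span a `k`-dimensional subspace of the tripod-law solutions -/
section OnPatterns

/-- membership in the apex-`1` fan relation: the chord `{0, 2l}` and the nested chords `{i, 2l+1−i}`, `2 ≤ i ≤ 2l−1`.
[cite: KhristoforovSmirnov2021, §1.2 (arXiv v1 p. 2); §2 Definition 3 (p. 4)] -/
theorem mem_fanRel_one {a b : Fin (2 * l + 1)} :
    (a, b) ∈ fanRel l 1 ↔
      (a.val + b.val = 2 * l ∧ (a.val = 0 ∨ b.val = 0)) ∨ (a.val + b.val = 2 * l + 1 ∧ 2 ≤ a.val ∧ 2 ≤ b.val) := by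
  rw [mem_fanRel]
  have := a.2; have := b.2
  omega

/-- ★ the apex-`1` fan `(1; {0,2l} + nested chords)` is a pattern (`2l+1 ≥ 3`).
[cite: KhristoforovSmirnov2021, §1.2 (arXiv v1 p. 2: the link pattern)] -/
theorem isPattern_fanRel_one (hl : 1 ≤ l) : IsPattern (⟨1, by omega⟩ : Fin (2 * l + 1)) (fanRel l 1) := by
  refine ⟨fun a b hab => ?_, fun a haa => ?_, fun a b hab => ?_, fun a ha => ?_, fun x y z w hxz hyw => ?_⟩
  · rw [mem_fanRel_one] at hab ⊢; omega
  · rw [mem_fanRel_one] at haa; omega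
  · rw [mem_fanRel_one] at hab
    intro e
    have h1 : a.val = 1 := by rw [e]
    omega
  · have ha' : a.val ≠ 1 := fun e => ha (Fin.ext e)
    have ha2 := a.2
    refine ⟨⟨if a.val = 0 then 2 * l else if a.val = 2 * l then 0 else 2 * l + 1 - a.val, by split_ifs <;> omega⟩, ?_, fun b hb => ?_⟩
    · show (a, (⟨if a.val = 0 then 2 * l else if a.val = 2 * l then 0 else 2 * l + 1 - a.val, _⟩ : Fin (2 * l + 1))) ∈ fanRel l 1
      rw [mem_fanRel_one]
      simp only
      split_ifs <;> omega
    · have hb : (a, b) ∈ fanRel l 1 := hb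
      rw [mem_fanRel_one] at hb
      apply Fin.ext
      simp only
      split_ifs <;> omega
  · rw [mem_fanRel_one] at hxz hyw
    unfold CcwQuad
    simp only [Fin.lt_def]
    omega

/-- the `t`-th rotated copy of the apex-`1` fan pattern, as an element of `Pat (2l+1)` (transport by `IsPattern.map`).
[cite: KhristoforovSmirnov2021, §1.2 (arXiv v1 p. 2)] -/
noncomputable def fanPat₁ (hl : 1 ≤ l) (t : ℕ) : Pat (2 * l + 1) :=
  ⟨((rot (2 * l + 1) ^ t) ⟨1, by omega⟩, relMap (rot (2 * l + 1) ^ t) (fanRel l 1)),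
    (isPattern_fanRel_one hl).map (isCyc_rot_pow (nm := 2 * l + 1) t)⟩

/-- the `s`-th rotated fan as a tripod-law solution on the patterns. [cite: KhristoforovSmirnov2021, §2 Lemma 4 (arXiv v1 p. 4); Remark 6 (p. 5)] -/
noncomputable def fanSol (l : ℕ) (s : Fin (2 * l + 1)) : solW (2 * l + 1) :=
  ⟨restrictW (rotW (rot (2 * l + 1) ^ s.val) (fanWt l)), tripodLaw_iff_restrict_mem_solW.1 (tripodLaw_rotW_fanWt l s.val)⟩

/-- ★★ **THE `k` ROTATED FANS ARE LINEARLY INDEPENDENT SOLUTIONS OF THE TRIPOD LAW** (`k = 2l+1 ≥ 5`, restricted to the patterns).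
[cite: KhristoforovSmirnov2021, §2 Definition 3 and Lemma 4 (arXiv v1 p. 4); Remark 6 (p. 5)] -/
theorem linearIndependent_fanSol (hl : 2 ≤ l) : LinearIndependent ℂ (fanSol l) := by
  rw [Fintype.linearIndependent_iff]
  intro g hg s₀
  set t : ℕ := 2 * l + 1 - s₀.val with ht
  have h := congrArg (fun w : solW (2 * l + 1) => (w : Pat (2 * l + 1) → ℂ) (fanPat₁ (by omega) t)) hg
  simp only [Submodule.coe_sum, Submodule.coe_smul, Finset.sum_apply, Pi.smul_apply, smul_eq_mul,
    Submodule.coe_zero, Pi.zero_apply] at h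
  have hev : ∀ s : Fin (2 * l + 1), (fanSol l s : Pat (2 * l + 1) → ℂ) (fanPat₁ (by omega : 1 ≤ l) t) =
      if (2 * l + 1) ∣ s.val + t then tau ^ 2 else 0 := fun s => rotW_fanWt_apply_rot hl s.val t
  have hs₀ := s₀.isLt
  rw [Finset.sum_eq_single s₀] at h
  · rw [hev, if_pos ⟨1, by omega⟩] at h
    exact (mul_eq_zero.1 h).resolve_right (pow_ne_zero _ tau_ne_zero_fr)
  · intro s _ hs
    rw [hev, if_neg, mul_zero]
    intro hdvd
    apply hs
    apply Fin.ext
    have hs' := s.isLt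
    obtain ⟨q, hq⟩ := hdvd
    rcases Nat.lt_or_ge q 2 with hq2 | hq2
    · interval_cases q <;> omega
    · have := Nat.mul_le_mul_left (2 * l + 1) hq2; omega
  · intro h0; exact absurd (Finset.mem_univ _) h0

/-- ★★ … hence **the tripod law at `k = 2l+1 ≥ 5` marks has at least `k` independent solutions**: `k ≤ dim solW k`
(`= #NCMatching (k+1)` by `finrank_solW_eq_card_ncMatching`; equality at `k = 5`, strict at `k = 7`).
[cite: KhristoforovSmirnov2021, §2 Lemma 4 (arXiv v1 p. 4); Remark 6 (p. 5)] -/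
theorem le_finrank_solW (hl : 2 ≤ l) : 2 * l + 1 ≤ Module.finrank ℂ (solW (2 * l + 1)) := by
  have h := (linearIndependent_fanSol hl).fintype_card_le_finrank
  rwa [Fintype.card_fin] at h

/-- ★ … and at least `k` non-crossing perfect matchings of `k + 1` points (bookkeeping through the tree's bijection).
[cite: KhristoforovSmirnov2021, §1.2 (arXiv v1 p. 2: link patterns)] -/
theorem le_card_ncMatching (hl : 2 ≤ l) : 2 * l + 1 ≤ Fintype.card (NCMatching (2 * l + 1 + 1)) := by
  rw [← finrank_solW_eq_card_ncMatching]
  exact le_finrank_solW hl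

end OnPatterns

end Literature.Probability.Percolation.MarkedLoops
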